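import Mathlib.Geometry.Manifold.Complex
import Mathlib.Geometry.Manifold.Riemannian.Basic
import Mathlib.Geometry.Manifold.VectorBundle.Riemannian
import Mathlib.Analysis.Normed.Module.Multilinear.Curry
import Mathlib.Topology.Algebra.Module.Alternating.Basic
import Mathlib.Analysis.Calculus.ContDiff.Operations
import Summits.Ventures.HodgeRepro2.HostAPI.Carriers.Geometry.Kaehler.ManifoldForms
import Summits.Ventures.HodgeRepro2.HostAPI.Util.ForallBinderLint
open HostAPI.Carriers

noncomputable section

open scoped Manifold ContDiff Topology
open Bundle

namespace HostAPI.Carriers.Geometry.Kaehler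

section RealStructure

variable {E : Type*} [NormedAddCommGroup E] [NormedSpace ℂ E]
  {M : Type*} [TopologicalSpace M] [ChartedSpace E M]

theorem isManifold_real_of_isManifold_complex [IsManifold 𝓘(ℂ, E) ω M] :
    IsManifold 𝓘(ℝ, E) ∞ M := by
  have hle : contDiffGroupoid ω 𝓘(ℂ, E) ≤ contDiffGroupoid ∞ 𝓘(ℝ, E) := by
    rw [contDiffGroupoid, contDiffGroupoid]
    apply groupoid_of_pregroupoid_le
    intro f s hfs
    exact ((hfs.of_le le_top).restrict_scalars ℝ :)
  have : HasGroupoid M (contDiffGroupoid ∞ 𝓘(ℝ, E)) := hasGroupoid_of_le inferInstance hle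
  exact IsManifold.mk' _ _ _

variable (E) in

def tangentJ (x : M) : TangentSpace 𝓘(ℝ, E) x →L[ℝ] TangentSpace 𝓘(ℝ, E) x :=
  ((Complex.I • ContinuousLinearMap.id ℂ E).restrictScalars ℝ : E →L[ℝ] E)

theorem tangentJ_apply (x : M) (v : TangentSpace 𝓘(ℝ, E) x) :
    tangentJ E x v = HSMul.hSMul (β := E) (γ := E) Complex.I v :=
  rfl

@[simp]
theorem tangentJ_tangentJ (x : M) (v : TangentSpace 𝓘(ℝ, E) x) :
    tangentJ E x (tangentJ E x v) = -v := by
  change (Complex.I • Complex.I • (show E from v) : E) = -(show E from v)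
  rw [smul_smul, Complex.I_mul_I, neg_one_smul]

end RealStructure

end HostAPI.Carriers.Geometry.Kaehler

namespace HostAPI.Carriers.Bundle.RiemannianMetric
open HostAPI.Carriers _root_.Bundle _root_.Bundle.RiemannianMetric

open HostAPI.Carriers.Geometry.Kaehler

variable {E : Type*} [NormedAddCommGroup E] [NormedSpace ℂ E]
  {M : Type*} [TopologicalSpace M] [ChartedSpace E M]

def IsHermitian (g : RiemannianMetric (fun x : M ↦ TangentSpace 𝓘(ℝ, E) x)) : Prop :=
  ∀ (x : M) (v w : TangentSpace 𝓘(ℝ, E) x),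
    g.inner x (tangentJ E x v) (tangentJ E x w) = g.inner x v w

def kaehlerForm (g : RiemannianMetric (fun x : M ↦ TangentSpace 𝓘(ℝ, E) x)) :
    MForm 𝓘(ℝ, E) M ℝ 2 := fun x ↦
  letI B : E →L[ℝ] E →L[ℝ] ℝ := (g.inner x).comp (tangentJ E x)
  letI β : E [⋀^Fin 2]→L[ℝ] ℝ := (2⁻¹ : ℝ) • ContinuousMultilinearMap.alternatization
    (ContinuousLinearMap.uncurryLeft
      (((continuousMultilinearCurryFin1 ℝ E ℝ).symm : (E →L[ℝ] ℝ) →L[ℝ] _).comp B))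
  β

theorem kaehlerForm_apply (g : RiemannianMetric (fun x : M ↦ TangentSpace 𝓘(ℝ, E) x)) (x : M)
    (v w : TangentSpace 𝓘(ℝ, E) x) :
    g.kaehlerForm x ![v, w] =
      2⁻¹ * (g.inner x (tangentJ E x v) w - g.inner x (tangentJ E x w) v) := by
  change (((2⁻¹ : ℝ) • ContinuousMultilinearMap.alternatization _ : E [⋀^Fin 2]→L[ℝ] ℝ))
    (show Fin 2 → E from ![v, w]) = _
  rw [ContinuousAlternatingMap.smul_apply,
    ContinuousMultilinearMap.alternatization_apply_apply]
  have huniv : (Finset.univ : Finset (Equiv.Perm (Fin 2))) = {1, Equiv.swap 0 1} := by decide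
  rw [huniv, Finset.sum_pair (by decide)]
  simp [Equiv.Perm.sign_swap', Units.smul_def, sub_eq_add_neg]
  rfl

theorem kaehlerForm_apply_of_isHermitian
    (g : RiemannianMetric (fun x : M ↦ TangentSpace 𝓘(ℝ, E) x)) (hg : g.IsHermitian) (x : M)
    (v w : TangentSpace 𝓘(ℝ, E) x) :
    g.kaehlerForm x ![v, w] = g.inner x (tangentJ E x v) w := by
  rw [kaehlerForm_apply]
  have h := hg x (tangentJ E x w) v
  rw [tangentJ_tangentJ, map_neg, neg_apply, g.symm x] at h
  linarith

theorem IsHermitian.kaehlerForm_tangentJ_tangentJ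
    {g : RiemannianMetric (fun x : M ↦ TangentSpace 𝓘(ℝ, E) x)} (hg : IsHermitian g) (x : M)
    (v w : TangentSpace 𝓘(ℝ, E) x) :
    g.kaehlerForm x ![tangentJ E x v, tangentJ E x w] = g.kaehlerForm x ![v, w] := by
  rw [kaehlerForm_apply_of_isHermitian g hg, kaehlerForm_apply_of_isHermitian g hg, hg]

theorem IsHermitian.inner_eq_kaehlerForm_tangentJ
    {g : RiemannianMetric (fun x : M ↦ TangentSpace 𝓘(ℝ, E) x)} (hg : IsHermitian g) (x : M)
    (v w : TangentSpace 𝓘(ℝ, E) x) :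
    g.inner x v w = g.kaehlerForm x ![v, tangentJ E x w] := by
  rw [kaehlerForm_apply_of_isHermitian g hg, hg]

theorem IsHermitian.kaehlerForm_nondegenerate
    {g : RiemannianMetric (fun x : M ↦ TangentSpace 𝓘(ℝ, E) x)} (hg : IsHermitian g) (x : M)
    (v : TangentSpace 𝓘(ℝ, E) x) (hv : v ≠ 0) :
    ∃ w : TangentSpace 𝓘(ℝ, E) x, g.kaehlerForm x ![v, w] ≠ 0 :=
  ⟨tangentJ E x v, by rw [← hg.inner_eq_kaehlerForm_tangentJ]; exact (g.pos x v hv).ne'⟩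

def IsKaehler (g : RiemannianMetric (fun x : M ↦ TangentSpace 𝓘(ℝ, E) x)) : Prop :=
  g.IsHermitian ∧ IsClosedForm g.kaehlerForm

theorem IsKaehler.isHermitian
    {g : RiemannianMetric (fun x : M ↦ TangentSpace 𝓘(ℝ, E) x)} (hg : IsKaehler g) : IsHermitian g :=
  hg.1

theorem IsKaehler.isClosedForm_kaehlerForm
    {g : RiemannianMetric (fun x : M ↦ TangentSpace 𝓘(ℝ, E) x)} (hg : IsKaehler g) :
    IsClosedForm (kaehlerForm g) :=
  hg.2

end HostAPI.Carriers.Bundle.RiemannianMetric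

namespace HostAPI.Carriers.Geometry.Kaehler

variable {E : Type*} [NormedAddCommGroup E] [NormedSpace ℂ E]
  {M : Type*} [TopologicalSpace M] [ChartedSpace E M] [IsManifold 𝓘(ℝ, E) ∞ M]

def isSmoothForm_kaehlerForm_of_isManifold_complex [FiniteDimensional ℂ E]
    [IsManifold 𝓘(ℂ, E) ω M] : Prop :=
  ∀ (g : ContMDiffRiemannianMetric 𝓘(ℝ, E) ∞ E (fun x : M ↦ TangentSpace 𝓘(ℝ, E) x)),
    IsSmoothForm g.toRiemannianMetric.kaehlerForm

variable [FiniteDimensional ℂ E] [IsManifold 𝓘(ℂ, E) ω M]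

def _root_.HostAPI.Carriers.Bundle.ContMDiffRiemannianMetric.kaehlerClass
    (h : isSmoothForm_kaehlerForm_of_isManifold_complex (E := E) (M := M))
    (g : ContMDiffRiemannianMetric 𝓘(ℝ, E) ∞ E (fun x : M ↦ TangentSpace 𝓘(ℝ, E) x))
    (hg : g.toRiemannianMetric.IsKaehler) : deRhamCohomology 𝓘(ℝ, E) M ℝ 2 :=
  deRhamCohomology.mk ⟨g.toRiemannianMetric.kaehlerForm,
    (mem_closedSmoothForms_iff _).2 ⟨h g, hg.2⟩⟩

variable (E M) in

class IsKaehlerManifold [FiniteDimensional ℂ E] [IsManifold 𝓘(ℂ, E) ω M] : Prop where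

  exists_isKaehler :
    ∃ g : ContMDiffRiemannianMetric 𝓘(ℝ, E) ∞ E (fun x : M ↦ TangentSpace 𝓘(ℝ, E) x),
      g.toRiemannianMetric.IsKaehler

section Flat

def isKaehler_riemannianMetricVectorSpace : Prop :=
  ∀ (V : Type*) [NormedAddCommGroup V] [InnerProductSpace ℂ V] [FiniteDimensional ℂ V],
    letI : InnerProductSpace ℝ V := InnerProductSpace.complexToReal
    (riemannianMetricVectorSpace V).toRiemannianMetric.IsKaehler

def isKaehlerManifold_vectorSpace : Prop :=
  ∀ (V : Type*) [NormedAddCommGroup V] [NormedSpace ℂ V] [FiniteDimensional ℂ V],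
    IsKaehlerManifold V V

end Flat

section NotAFact

theorem not_forall_isHermitian :
    ¬ ∀ g : RiemannianMetric (fun x : ℂ ↦ TangentSpace 𝓘(ℝ, ℂ) x), g.IsHermitian := by
  intro h

  let B : ℂ →L[ℝ] ℂ →L[ℝ] ℝ :=
    (innerSL ℝ : ℂ →L[ℝ] ℂ →L[ℝ] ℝ) +
      (ContinuousLinearMap.mul ℝ ℝ).bilinearComp Complex.reCLM Complex.reCLM
  have hB : ∀ v w : ℂ, B v w = inner ℝ v w + v.re * w.re := fun v w ↦ by
    simp only [B, add_apply, ContinuousLinearMap.bilinearComp_apply,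
      ContinuousLinearMap.mul_apply', Complex.reCLM_apply]
    rfl
  have hBself : ∀ v : ℂ, B v v = ‖v‖ ^ 2 + v.re * v.re := fun v ↦ by
    rw [hB, real_inner_self_eq_norm_sq]

  let g : RiemannianMetric (fun x : ℂ ↦ TangentSpace 𝓘(ℝ, ℂ) x) :=
    { inner := fun _ ↦ B
      symm := fun _ v w ↦ by
        change B v w = B w v
        rw [hB, hB, real_inner_comm, mul_comm]
      pos := fun _ v hv ↦ by
        change 0 < B v v
        rw [hBself]
        have : 0 < ‖(show ℂ from v)‖ := norm_pos_iff.2 hv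
        nlinarith [mul_self_nonneg (show ℂ from v).re]
      continuousAt := fun _ ↦ by
        change ContinuousAt (fun v : ℂ ↦ B v v) 0
        exact (B.continuous₂.comp (continuous_id.prodMk continuous_id)).continuousAt
      isVonNBounded := fun _ ↦ by
        change Bornology.IsVonNBounded ℝ {v : ℂ | B v v < 1}
        refine (NormedSpace.isVonNBounded_ball ℝ ℂ 1).subset ?_
        intro v hv
        rw [Set.mem_setOf_eq, hBself] at hv
        rw [Metric.mem_ball, dist_zero_right]
        nlinarith [mul_self_nonneg v.re, norm_nonneg v] }

  have h1 := h g 0 (1 : ℂ) (1 : ℂ)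
  rw [tangentJ_apply] at h1
  change B (Complex.I • (1 : ℂ)) (Complex.I • 1) = B 1 1 at h1
  rw [hBself, hBself] at h1
  norm_num at h1

end NotAFact

end HostAPI.Carriers.Geometry.Kaehler
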